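import Summits.BirchSwinnertonDyer.BirchSwinnertonDyer.Theorems.ResidualThetaTransportAtTwoThetaLayerLambdaCongruenceAtTwoManinSymbols
import HarnessLib

/-!
# Crux `ThetaLayerLambdaCongruenceAtTwo` (stmt-BirchSwinnertonDyer-20688, route ResidualThetaTransportAtTwo), line
# `birth`, stub (C3k) — ITEM B1 scaffolding, continued: MANIN'S TRICK for symbol functions — a function
# `Φ : ℚ → R` is a sum of its Manin symbols (lead prover bsd-wall-rtt-p3 g3;
# `--supports stmt-BirchSwinnertonDyer-20688 --as helper`; closes nothing)

HONEST FRAMING. Elementary THEOREMS about functions `Φ : ℚ → R` only (no Manin relation is even needed in §1);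
nothing about any curve or form is asserted; BSD is not proved by any of this.

WHAT. With `Φ̂(k) = Φ(k·∞)` (`0` at `∞`) and the Manin symbol `[g]_Φ = Φ̂(g) − Φ̂(gS)` of `…ManinSymbols`:
* §1 MANIN'S TRICK (continued fractions / Euclid on the first column, the pattern of the tree's
  `ModularForms.exists_chain`): for EVERY `Φ : ℚ → R` and every subgroup `S' ≤ R`, if all Manin symbols
  `[g]_Φ`, `g ∈ SL₂(ℤ)`, lie in `S'` then `Φ̂(k) ∈ S'` for all `k` and `Φ(r) ∈ S'` for all `r ∈ ℚ`
  (`maninCusp_mem_of_forall_maninSymbol_mem`, `mem_of_forall_maninSymbol_mem`); with `S' = 0`: a function is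
  DETERMINED by its Manin symbols (`eq_zero_of_forall_maninSymbol_eq_zero`) — injectivity of
  `Symb_Γ(R) → {Manin symbols}` (the surjectivity onto systems satisfying the 2- and 3-term relations is Manin's
  Thm. 1.9 / Wiese Prop. 5.1, NOT here).
* §2 combined with `…ManinSymbols` §3: for `N` odd and a Γ₀(N)-symbol function `Φ` killed by `T₂` (resp.
  `T₂`-eigen modulo the unit ball with non-unit eigenvalue), the Manin symbols on the σ-FIXED cosets are
  automatically `0` (resp. small), so `Φ` is determined (resp. determined mod `𝔪`) by its Manin symbols on the
  cosets `Γ₀(N)g` with `Γ₀(N)gS ≠ Γ₀(N)g` (`mem_of_maninSymbol_mem_of_not_sigmaFixed`): the `𝔪`-eigen symbol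
  functions of (C3k) are functions on the FREE `S`-orbits of `P¹(ℤ/N')` — the coordinates of the torsion-free
  Manin-symbol module.

References: [Manin1972] Thm. 1.6, Thm. 1.9; [CremonaAlgorithms1997] §2.2–2.3; Wiese, Computational arithmetic of
modular forms (in [InamBuyukasik2019]) Prop. 5.1, Thm. 5.7.
-/

noncomputable section

-- justification: the `Summit.BirchSwinnertonDyer.BirchSwinnertonDyer.…` path repeats a component (route-file convention)
set_option linter.dupNamespace false

open scoped Classical MatrixGroups

open CongruenceSubgroup Matrix.SpecialLinearGroup ModularGroup

namespace Summit.BirchSwinnertonDyer.BirchSwinnertonDyer.Theorems.ThetaLayerLambdaCongruenceAtTwo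

variable {R : Type*} [AddCommGroup R] {N : ℕ}

/-! ## §1. Manin's trick: `Φ̂(k)` is a sum of Manin symbols of `Φ` -/

section ManinTrick

/-- **Manin's trick.** For ANY function `Φ : ℚ → R` and subgroup `S' ≤ R`: if every Manin symbol
`[g]_Φ = Φ̂(g) − Φ̂(gS)` (`g ∈ SL₂(ℤ)`) lies in `S'`, then every cusp value `Φ̂(k)` lies in `S'`. Induction on
`|k₁₀|`: for `k₁₀ ≠ 0` and `m = −⌊k₁₁/k₁₀⌋`, `k' = kTᵐS` has `|k'₁₀| < |k₁₀|` and `Φ̂(k) − Φ̂(k') = [kTᵐ]_Φ`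
(`kTᵐ` has the first column of `k`). [cite: Manin1972, Thm. 1.6] -/
theorem maninCusp_mem_of_forall_maninSymbol_mem (Φ : ℚ → R) (S' : AddSubgroup R)
    (h : ∀ g : SL(2, ℤ), ((if (g 1 0) = 0 then 0 else Φ (((g 0 0 : ℚ)) / ((g 1 0 : ℚ)))) -
      (if ((g * ModularGroup.S) 1 0) = 0 then 0 else Φ ((((g * ModularGroup.S) 0 0 : ℚ)) / (((g * ModularGroup.S) 1 0 : ℚ))))) ∈ S')
    (k : SL(2, ℤ)) : (if (k 1 0) = 0 then 0 else Φ (((k 0 0 : ℚ)) / ((k 1 0 : ℚ)))) ∈ S' := by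
  suffices H : ∀ n : ℕ, ∀ k : SL(2, ℤ), (k 1 0).natAbs = n → (if (k 1 0) = 0 then 0 else Φ (((k 0 0 : ℚ)) / ((k 1 0 : ℚ)))) ∈ S' from H _ k rfl
  intro n
  induction n using Nat.strong_induction_on with
  | _ n ih =>
    intro k hk
    by_cases hz : k 1 0 = 0
    · rw [if_pos hz]; exact S'.zero_mem
    · -- Euclidean step
      set m : ℤ := -(k 1 1 / k 1 0) with hm
      set k' : SL(2, ℤ) := k * T ^ m * S with hk'
      have hk'10 : k' 1 0 = k 1 1 % k 1 0 := by
        simp only [hk', coe_mul, coe_S, coe_T_zpow, Matrix.mul_apply, Fin.sum_univ_two]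
        simp [hm, Int.emod_def]
        ring
      have hlt : (k' 1 0).natAbs < n := by
        rw [← hk, hk'10]
        have h0 := Int.emod_nonneg (k 1 1) hz
        have h1 := Int.emod_lt_abs (k 1 1) hz
        zify
        rw [abs_of_nonneg h0]
        exact h1
      have ih' := ih _ hlt k' rfl
      have hg := h (k * T ^ m)
      have e00 : (k * T ^ m) 0 0 = k 0 0 := by
        simp [coe_mul, coe_T_zpow, Matrix.mul_apply, Fin.sum_univ_two]
      have e10 : (k * T ^ m) 1 0 = k 1 0 := by
        simp [coe_mul, coe_T_zpow, Matrix.mul_apply, Fin.sum_univ_two]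
      rw [e00, e10] at hg
      have e : (if (k 1 0) = 0 then 0 else Φ (((k 0 0 : ℚ)) / ((k 1 0 : ℚ)))) =
          ((if (k 1 0) = 0 then 0 else Φ (((k 0 0 : ℚ)) / ((k 1 0 : ℚ)))) - (if ((k * T ^ m * ModularGroup.S) 1 0) = 0 then 0 else Φ ((((k * T ^ m * ModularGroup.S) 0 0 : ℚ)) / (((k * T ^ m * ModularGroup.S) 1 0 : ℚ))))) +
          (if ((k * T ^ m * ModularGroup.S) 1 0) = 0 then 0 else Φ ((((k * T ^ m * ModularGroup.S) 0 0 : ℚ)) / (((k * T ^ m * ModularGroup.S) 1 0 : ℚ)))) := by abel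
      rw [e]
      exact S'.add_mem hg ih'

/-- **A function on `ℚ` is controlled by its Manin symbols**: if all `[g]_Φ ∈ S'` then all `Φ(r) ∈ S'`
(`r = k·∞` for a Bezout matrix `k`, inlined). [cite: Manin1972, Thm. 1.6] -/
theorem mem_of_forall_maninSymbol_mem (Φ : ℚ → R) (S' : AddSubgroup R)
    (h : ∀ g : SL(2, ℤ), ((if (g 1 0) = 0 then 0 else Φ (((g 0 0 : ℚ)) / ((g 1 0 : ℚ)))) -
      (if ((g * ModularGroup.S) 1 0) = 0 then 0 else Φ ((((g * ModularGroup.S) 0 0 : ℚ)) / (((g * ModularGroup.S) 1 0 : ℚ))))) ∈ S')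
    (r : ℚ) : Φ r ∈ S' := by
  -- Bezout: `r = k·∞` for `k = (num r, -v; den r, u)` (as in the tree's
  -- `…KimAtThreeDeepLowerOffStratumLevelLoweringCanonicalPeriod.exists_sl_apply_eq_num_den`, inlined to keep
  -- this file's imports inside the crux's cone)
  obtain ⟨k, h0, h1⟩ : ∃ k : SL(2, ℤ), k 0 0 = r.num ∧ k 1 0 = r.den := by
    have hcop : Int.gcd r.num (r.den : ℤ) = 1 := by
      change r.num.natAbs.gcd (r.den : ℤ).natAbs = 1
      rw [Int.natAbs_natCast]
      exact r.reduced
    have hbez := Int.gcd_eq_gcd_ab r.num (r.den : ℤ)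
    rw [hcop, Nat.cast_one] at hbez
    exact ⟨⟨!![r.num, -Int.gcdB r.num (r.den : ℤ); (r.den : ℤ), Int.gcdA r.num (r.den : ℤ)], by
      rw [Matrix.det_fin_two_of]; linear_combination -hbez⟩, rfl, rfl⟩
  have hk := maninCusp_mem_of_forall_maninSymbol_mem Φ S' h k
  have hne : k 1 0 ≠ 0 := by rw [h1]; exact_mod_cast r.den_ne_zero
  rw [if_neg hne, h0, h1] at hk
  have e : ((r.num : ℤ) : ℚ) / (((r.den : ℕ) : ℤ) : ℚ) = r := by push_cast; exact Rat.num_div_den r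
  rwa [e] at hk

/-- **A function on `ℚ` is DETERMINED by its Manin symbols** (injectivity of `Φ ↦ ([g]_Φ)_g`; apply to a
difference `Φ₁ − Φ₂`): if all Manin symbols vanish, `Φ = 0`. [cite: Manin1972, Thm. 1.6] -/
theorem eq_zero_of_forall_maninSymbol_eq_zero (Φ : ℚ → R)
    (h : ∀ g : SL(2, ℤ), ((if (g 1 0) = 0 then 0 else Φ (((g 0 0 : ℚ)) / ((g 1 0 : ℚ)))) -
      (if ((g * ModularGroup.S) 1 0) = 0 then 0 else Φ ((((g * ModularGroup.S) 0 0 : ℚ)) / (((g * ModularGroup.S) 1 0 : ℚ))))) = 0)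
    (r : ℚ) : Φ r = 0 :=
  (AddSubgroup.mem_bot).mp (mem_of_forall_maninSymbol_mem Φ ⊥ (fun g ↦ by rw [h g]; exact (⊥ : AddSubgroup R).zero_mem) r)

end ManinTrick

/-! ## §2. Eigen-symbols are determined by their Manin symbols on the free `S`-orbits -/

section Eigen

variable {Φ : ℚ → R}

/-- **`T₂`-killed symbol functions are determined modulo `S'` by their Manin symbols on the non-σ-fixed cosets**:
`N` odd, `Φ` a Γ₀(N)-symbol function with `T₂Φ = 0`; if `[g]_Φ ∈ S'` for every `g` whose coset is NOT fixed by
`S` (no `γ ∈ Γ₀(N)` with `γg = gS`), then `Φ(r) ∈ S'` for all `r` — the σ-fixed cosets contribute `0` by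
`maninSymbol_eq_zero_of_sigmaFixed_of_heckeTwo`. [cite: Merel1994, §1.2–1.3] -/
theorem mem_of_maninSymbol_mem_of_not_sigmaFixed (hN : Odd N)
    (hM : ∀ (γ : Gamma0 N) (r : ℚ), ((γ : SL(2, ℤ)) 1 0 : ℚ) * r + ((γ : SL(2, ℤ)) 1 1 : ℚ) ≠ 0 →
      Φ ((((γ : SL(2, ℤ)) 0 0 : ℚ) * r + ((γ : SL(2, ℤ)) 0 1 : ℚ)) /
        (((γ : SL(2, ℤ)) 1 0 : ℚ) * r + ((γ : SL(2, ℤ)) 1 1 : ℚ))) =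
        (if ((γ : SL(2, ℤ)) 1 0) = 0 then 0 else Φ ((((γ : SL(2, ℤ)) 0 0 : ℚ)) / (((γ : SL(2, ℤ)) 1 0 : ℚ)))) + Φ r)
    (hT : ∀ x : ℚ, (∑ j : Fin 2, Φ ((x + j) / 2)) + Φ (2 * x) = 0)
    (S' : AddSubgroup R)
    (h : ∀ g : SL(2, ℤ), (¬ ∃ γ : Gamma0 N, (γ : SL(2, ℤ)) * g = g * ModularGroup.S) →
      ((if (g 1 0) = 0 then 0 else Φ (((g 0 0 : ℚ)) / ((g 1 0 : ℚ)))) -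
      (if ((g * ModularGroup.S) 1 0) = 0 then 0 else Φ ((((g * ModularGroup.S) 0 0 : ℚ)) / (((g * ModularGroup.S) 1 0 : ℚ))))) ∈ S')
    (r : ℚ) : Φ r ∈ S' := by
  refine mem_of_forall_maninSymbol_mem Φ S' (fun g ↦ ?_) r
  by_cases hfix : ∃ γ : Gamma0 N, (γ : SL(2, ℤ)) * g = g * ModularGroup.S
  · obtain ⟨γ, hγ⟩ := hfix
    rw [maninSymbol_eq_zero_of_sigmaFixed_of_heckeTwo hN hM hT γ g hγ]
    exact S'.zero_mem
  · exact h g hfix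

end Eigen

end Summit.BirchSwinnertonDyer.BirchSwinnertonDyer.Theorems.ThetaLayerLambdaCongruenceAtTwo

end
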